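import Literature.Computability.Complexity.ToranWitness
import Literature.Computability.Complexity.PRelAdaptiveForm
import Literature.Computability.Complexity.CountingHierarchyProofs
import HarnessLib

/-!
# Torán's oracle characterisation of the counting hierarchy: `Cₖ₊₁P = PP^{CₖP}` (proof)

Sibling proof file of `CountingHierarchy.lean` (D-0014). It discharges the named fact
`Literature.Computability.Complexity.CkP_succ_eq_PPRelClass` —
**`∀ k, CₖP (k+1) = PPRelClass (CₖP k)`**, i.e. `C'·CₖP = ⋃_{B ∈ CₖP} PP^B` with `PP^B = C'·(P^B)`
(J. Torán, *Complexity classes defined by counting quantifiers*, J. ACM 38 (1991) 753–774, §4;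
quoted as (3) in Bürgisser 2009, §2.1) — as `CkP_succ_eq_PPRelClass_holds`.

## The proof

* `⊆`: a witness language `W ∈ CₖP` of `L ∈ C'·CₖP` is in `P^W` (`self_mem_PRel_ofLanguage_holds`),
  so `L ∈ C'·(P^W) = PP^W`.
* `⊇`, by induction on `k` from the **relativised level-one theorem**
  `Literature.Computability.Complexity.pMajority_PRel_subset_of_mem_pMajority`:
  for every oracle `O` and every `A ∈ C'·(P^O)`, `C'·(P^A) ⊆ C'·C'·(P^O)`.
  (`k = 0`: `P^A = P` for `A ∈ P`, `PRelClass_P_subset_P`; step: `A ∈ Cₖ₊₁P = C'·CₖP` has a witness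
  `B ∈ CₖP ⊆ P^B`, so `PP^A ⊆ C'·C'·(P^B) ⊆ C'·Cₖ₊₁P = Cₖ₊₂P` by the induction hypothesis
  `C'·(P^B) = PP^B ⊆ Cₖ₊₁P` and monotonicity of `C'·`.)
* The level-one theorem (Torán's printed proof is not available to the tree; this is a
  count-guessing argument in the transcript model of `Oracle.lean`). Let `L ∈ C'·(P^A)` with `m`
  coins and witness `W ∈ P^A`, in the normal form `W = adLang Q q D_W A` of
  `PRelAdaptiveForm.lean` (`T = q(|w|)` adaptive queries `z_j = Q ⟨w, answers so far⟩`), and let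
  `A = {z | 2^{r|z|} < 2·κ(z)}`, `κ(z) = #{c ∈ {0,1}^{r|z|} | ⟨z, c⟩ ∈ D_A}`, `D_A ∈ P^O`. The new
  outer coins are `u = d b₁ b₂ · y · as · γ`: guessed answer bits `as ∈ {0,1}^T` and guessed COUNTS
  `γ = γ₀ ⋯ γ_{T-1}` (blocks of `Bw = R + 1` bits, `2^R` bounding every `κ(z_j)`). A guess is
  consistent (`Cons`) when every `as_j` is the threshold bit of `γ_j` at `z_j`; then
  (`ToranCH.cons_and_F_eq_iff`) the aggregated true count `F = Σ_j 2^{j·Bw} κ(z_j)` equals the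
  numeral `val γ` iff `(as, γ)` is the true transcript with the true counts, and
  `[F = val γ] = [val γ ≤ F] + [F ≤ val γ] − 1`. The inner vote (witness `ToranCH.𝒲 ∈ P^O`, a
  ONE-query truth-table reduction to `D_A`, `ToranWitness.lean`) decides `val γ ≤ F` on the strings
  with `d b₁ = 00` and `F ≤ val γ` on `d b₁ = 01` (the second through the COMPLEMENT of the witness
  set, i.e. the negative oracle answer — this is where a second, independent threshold is needed),
  accepts the inconsistent strings iff `b₁ = 1`, and uses `d = 1` to shift the threshold by `2^m`;
  by `ToranCH.cnt_Ehat` exactly `2^{N+2} + 2·#{y | w ∈ W} − 2^m` of the `2^{N+3}` strings `u` are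
  accepted, a strict majority iff `x ∈ L`.

## References

* J. Torán, *Complexity classes defined by counting quantifiers*, J. ACM 38 (1991) 753–774, §4.
* P. Bürgisser, *On defining integers and proving arithmetic circuit lower bounds*, Comput.
  Complexity 18 (2009) 81–103 = ECCC TR06-113, §2.1 (3).
* E. Allender, K. W. Wagner, *Counting hierarchies: polynomial time and constant depth circuits*,
  Bull. EATCS 40 (1990) (survey stating Torán's characterisation).
* S. Arora, B. Barak, *Computational Complexity: A Modern Approach*, CUP 2009, §17.2.1, §3.4.
-/

namespace Literature.Computability.Complexity

open _root_.Computability Polynomial PRelSigma TTClosure AdQuery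

namespace ToranCH

/-! ### The witness language `𝒲 ∈ P^O` and the inner vote -/

section Witness

variable (P : Data)

/-- **The inner witness language** `𝒲`: the one-query truth-table reduction with query `gS` and
evaluator `EW` to the witness `DA` of `A`. [cite: Toran1991, §4] -/
noncomputable def 𝒲 : Language Bool := ttLang (gS P ∘ fstP) 1 (EW P) P.DA

/-- **The inner vote** `Evote = {v | Pr_c[⟨v, c⟩ ∈ 𝒲] > 1/2}` with `C0P(|v|)` coins. [cite: Toran1991, §4] -/
noncomputable def Evote : Language Bool :=
  {v | 1 / 2 < uniformProb (P.C0P.eval v.length) {c | boolPair v c ∈ 𝒲 P}}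

/-- The consistency predicate of the outer count, as a function of `y`, `as`, `γ`. [cite: Toran1991, §4] -/
def ConsP (x y as γ : List Bool) : Prop :=
  Cons P.Q P.ρ (boolPair x y) (P.TP.eval x.length) (P.BwP.eval x.length) as γ
/-- The acceptance predicate of the outer count: `⟨⟨x, y⟩, as⟩ ∈ DW`. [cite: Toran1991, §4] -/
def OutP (x y as : List Bool) : Prop := boolPair (boolPair x y) as ∈ P.DW
/-- The aggregated true count of the outer count. [cite: Toran1991, §4] -/
noncomputable def FvP (x y as : List Bool) : ℕ :=
  Fval P.Q P.κ (boolPair x y) (P.TP.eval x.length) (P.BwP.eval x.length) as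

variable {P}

/-- `𝒲 ∈ P^O` when `Q ∈ FP`, `DW ∈ P`, `DA ∈ P^O` (`P^{DA} ⊆ P^{P^O} = P^O`). [cite: Toran1991, §4] -/
theorem 𝒲_mem_PRel {O : Oracle} (hQ : P.Q ∈ FP) (hDW : P.DW ∈ Classes.P) (hDA : P.DA ∈ PRel O) :
    𝒲 P ∈ PRel O :=
  mem_PRel_of_polyTimeTuringReducible_holds
    (ttLang_mem_PRel (comp_mem_FP (gS_mem_FP hQ) fstP_mem_FP) (EW_mem_P hQ hDW) P.DA) hDA

/-- `Evote ∈ C'·(P^O)`. [cite: Toran1991, §4] -/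
theorem Evote_mem_pMajority {O : Oracle} (hQ : P.Q ∈ FP) (hDW : P.DW ∈ Classes.P) (hDA : P.DA ∈ PRel O) :
    Evote P ∈ pMajority (PRel O) :=
  ⟨𝒲 P, 𝒲_mem_PRel hQ hDW hDA, P.C0P, fun _ => Iff.rfl⟩

end Witness

/-! ### Reading `𝒲` and counting the inner vote -/

section Inner

variable (P : Data) (x : List Bool) (d b₁ b₂ : Bool) (rest : List Bool)

local notation "mm" => Polynomial.eval (List.length x) (Data.p P)
local notation "TT" => Polynomial.eval (List.length x) (Data.TP P)
local notation "BW" => Polynomial.eval (List.length x) (Data.BwP P)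
local notation "RR" => Polynomial.eval (List.length x) (Data.RP P)
local notation "ww" => boolPair x (List.take (Polynomial.eval (List.length x) (Data.p P)) rest)
local notation "AS" => List.take (Polynomial.eval (List.length x) (Data.TP P))
  (List.drop (Polynomial.eval (List.length x) (Data.p P)) rest)
local notation "GA" => List.drop (Polynomial.eval (List.length x) (Data.p P) + Polynomial.eval (List.length x) (Data.TP P)) rest
local notation "vv" => boolPair x (d :: b₁ :: b₂ :: rest)
local notation "v00" => boolPair x (false :: false :: b₂ :: rest)
local notation "v01" => boolPair x (false :: true :: b₂ :: rest)
local notation "CO" => (Cons (Data.Q P) (Data.ρ P) ww TT BW AS GA ∧ boolPair ww AS ∈ Data.DW P)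
local notation "S0" => S0set TT BW (fun j => Data.ρ P (qry (Data.Q P) ww AS j))
  (fun j => setOf (fun c => boolPair (qry (Data.Q P) ww AS j) c ∈ Data.DA P))

/-- One answer bit. [folklore] -/
theorem ttBits_one (Q : List Bool → List Bool) (A : Language Bool) (z : List Bool) :
    ttBits Q A z 1 = [A.boolIndicator (Q (boolPair z []))] := by
  rw [show (1 : ℕ) = 0 + 1 from rfl, ttBits_succ]
  simp [ttBits]

/-- **Reading `𝒲`.** [cite: Toran1991, §4] -/
theorem mem_𝒲_iff (e e' : Bool) (c'' : List Bool) (hrest : mm + TT ≤ rest.length) :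
    boolPair vv (e :: e' :: c'') ∈ 𝒲 P ↔
      ((((d = false ∧ b₁ = false) ∧ CO) ∧
          ((e = true ∧ (true ∉ e' :: c'' ∨ c'' ∈ S0)) ∨ (e = false ∧ ¬ bitsToNat (e' :: c'') < 2 * bitsToNat GA))) ∨
        (((d = false ∧ b₁ = true) ∧ CO) ∧
          ((e = true ∧ c'' ∉ S0) ∨ (e = false ∧ bitsToNat (e' :: c'') < 2 * bitsToNat GA + 1)))) ∨
      (((d = false ∧ ¬ CO) ∧ b₁ = true) ∨ ((d = true ∧ b₁ = false) ∧ ¬ (b₂ = false ∧ true ∉ rest.drop mm))) := by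
  have hfmt := fmtS_and_iff P x d b₁ b₂ rest e e' c''
  have hbit : ([P.DA.boolIndicator (gS P (boolPair vv (e :: e' :: c'')))] : List Bool).head? = some true ↔
      gS P (boolPair vv (e :: e' :: c'')) ∈ P.DA := by
    rw [List.head?_cons, Option.some.injEq, boolIndicator_eq_true_iff']
  have hn : ∀ p q : Prop, (¬ p ∨ ¬ q) ↔ ¬ (p ∧ q) := fun p q =>
    ⟨fun h hpq => h.elim (fun hp => hp hpq.1) fun hq => hq hpq.2, fun h => by
      by_cases hp : p
      · exact Or.inr fun hq => h ⟨hp, hq⟩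
      · exact Or.inl hp⟩
  rw [𝒲, mem_ttLang_iff, eval_one, ttBits_one, Function.comp_apply, fstP_boolPair]
  rw [mem_EW_iff P x d b₁ b₂ rest e e' c'' _ hrest, Ne, hn, hbit, ← hfmt]

variable {P x d b₁ b₂ rest}

/-- Splitting a count by the first coin, through a pointwise description. [folklore] -/
theorem cnt_succ_of_iff (K : ℕ) (S : Set (List Bool)) (R : Bool → List Bool → Prop)
    (h : ∀ (e : Bool) (c : List Bool), (e :: c) ∈ S ↔ R e c) :
    cnt (K + 1) S = cnt K {c | R false c} + cnt K {c | R true c} := by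
  rw [cnt_succ]
  congr 1 <;> exact cnt_congr fun c _ => h _ c

/-- A string of length `K + 2` has two leading bits. [folklore] -/
theorem exists_eq_cons_cons {c : List Bool} {K : ℕ} (h : c.length = K + 2) : ∃ e e' c'', c = e :: e' :: c'' := by
  match c, h with
  | e :: e' :: c'', _ => exact ⟨e, e', c'', rfl⟩

/-- A string of length `K + 1` has a leading bit. [folklore] -/
theorem exists_eq_cons {c : List Bool} {K : ℕ} (h : c.length = K + 1) : ∃ e c'', c = e :: c'' := by
  match c, h with
  | e :: c'', _ => exact ⟨e, c'', rfl⟩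

/-- Strings of the witness set contain a `1` (the pair separator). [folklore] -/
theorem true_mem_of_mem_S0set {T Bw : ℕ} {ρj : ℕ → ℕ} {Dj : ℕ → Set (List Bool)} {c : List Bool}
    (h : c ∈ S0set T Bw ρj Dj) : true ∈ c := by
  obtain ⟨j, -, rs, rfl, -⟩ := h
  simp [boolPair]

variable (P x rest) in
/-- The inner coins: `C0P(|v|) = K + 2` with `K ≥ 2T + T·Bw + R`. [folklore] -/
theorem exists_K : ∃ K, P.C0P.eval (2 * x.length + 2 + (rest.length + 3)) = K + 2 ∧ 2 * TT + TT * BW + RR ≤ K := by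
  have hmono : P.C0P.eval x.length ≤ P.C0P.eval (2 * x.length + 2 + (rest.length + 3)) := TM2Iter.eval_mono _ (by omega)
  rw [Data.eval_C0P] at hmono
  exact ⟨P.C0P.eval (2 * x.length + 2 + (rest.length + 3)) - 2, by omega, by omega⟩

/-- Query lengths along any guess are `≤ Z`, so `ρ ≤ R`. [folklore] -/
theorem rho_qry_le (hs : ∀ z, (P.Q z).length ≤ P.s.eval z.length) (x y as : List Bool) (hy : y.length = P.p.eval x.length)
    {j : ℕ} (hj : j ≤ P.TP.eval x.length) :
    P.ρ (qry P.Q (boolPair x y) as j) ≤ P.RP.eval x.length := by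
  rw [Data.ρ, Data.eval_RP]
  refine TM2Iter.eval_mono _ ((hs _).trans ?_)
  rw [Data.eval_ZP, Data.eval_ellP]
  refine TM2Iter.eval_mono _ ?_
  rw [length_boolPair, length_boolPair, hy, List.length_take]
  have := min_le_left j as.length
  omega

/-- `κ(z_j) < 2^{Bw}` along every guess. [folklore] -/
theorem kappa_qry_lt (hs : ∀ z, (P.Q z).length ≤ P.s.eval z.length) (x y as : List Bool) (hy : y.length = P.p.eval x.length)
    {j : ℕ} (hj : j < P.TP.eval x.length) :
    P.κ (qry P.Q (boolPair x y) as j) < 2 ^ P.BwP.eval x.length := by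
  rw [Data.eval_BwP]
  refine lt_of_le_of_lt ?_ (Nat.pow_lt_pow_right (by norm_num) (Nat.lt_succ_of_le (rho_qry_le hs x y as hy hj.le)))
  exact cnt_le _ _

variable (P x b₂ rest)

/-- **The inner count, branch `val γ ≤ F`** (`d = 0`, `b₁ = 0`, consistent and accepting):
`2·#accepted + 4·val γ = 2^{K+2} + 2(2·#S0 + 1)`. [cite: Toran1991, §4] -/
theorem two_mul_cnt_inner_le (K : ℕ) (hrest : mm + TT ≤ rest.length) (hΓ : 2 * bitsToNat GA ≤ 2 ^ (K + 1)) (hco : CO) :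
    2 * cnt (K + 2) {c | boolPair v00 c ∈ 𝒲 P} + 4 * bitsToNat GA = 2 ^ (K + 2) + 2 * (2 * cnt K S0 + 1) := by
  have hread : ∀ (e e' : Bool) (c'' : List Bool), boolPair v00 (e :: e' :: c'') ∈ 𝒲 P ↔
      ((e = true ∧ (true ∉ e' :: c'' ∨ c'' ∈ S0)) ∨ (e = false ∧ ¬ bitsToNat (e' :: c'') < 2 * bitsToNat GA)) := by
    intro e e' c''
    rw [mem_𝒲_iff P x false false b₂ rest e e' c'' hrest]
    constructor
    · rintro ((⟨-, h⟩ | ⟨⟨⟨-, h⟩, -⟩, -⟩) | (⟨-, h⟩ | ⟨⟨h, -⟩, -⟩))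
      · exact h
      · cases h
      · cases h
      · cases h
    · intro h
      exact Or.inl (Or.inl ⟨⟨⟨rfl, rfl⟩, hco⟩, h⟩)
  rw [cnt_succ]
  -- `e = 0`: numerals `≥ 2 val γ`
  have h0 : cnt (K + 1) {c | false :: c ∈ {c | boolPair v00 c ∈ 𝒲 P}} = 2 ^ (K + 1) - 2 * bitsToNat GA := by
    rw [← ThresholdPP.cnt_ge]
    refine cnt_congr fun c hc => ?_
    obtain ⟨e', c'', rfl⟩ := exists_eq_cons hc
    change boolPair v00 (false :: e' :: c'') ∈ 𝒲 P ↔ 2 * bitsToNat GA ≤ bitsToNat (e' :: c'')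
    rw [hread, not_lt]
    simp
  -- `e = 1`: the witness set twice, plus the all-zero string
  have h1 : cnt (K + 1) {c | true :: c ∈ {c | boolPair v00 c ∈ 𝒲 P}} = 2 * cnt K S0 + 1 := by
    rw [cnt_succ_of_iff K _ (fun e' c'' => true ∉ e' :: c'' ∨ c'' ∈ S0) (fun e' c'' => by
      change boolPair v00 (true :: e' :: c'') ∈ 𝒲 P ↔ _
      rw [hread]; simp)]
    have ht : cnt K {c'' | true ∉ true :: c'' ∨ c'' ∈ S0} = cnt K S0 := cnt_congr fun c _ => by simp
    have hf : cnt K {c'' | true ∉ false :: c'' ∨ c'' ∈ S0} = cnt K S0 + 1 := by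
      have hu : ({c'' : List Bool | true ∉ c''} ∪ S0) = {c'' | true ∉ false :: c'' ∨ c'' ∈ S0} := by
        ext c; simp
      have hi : ({c'' : List Bool | true ∉ c''} ∩ S0) = ∅ := by
        ext c
        simp only [Set.mem_inter_iff, Set.mem_setOf_eq, Set.mem_empty_iff_false, iff_false, not_and]
        exact fun h hS => h (true_mem_of_mem_S0set hS)
      have h := cnt_add_cnt_eq K {c'' : List Bool | true ∉ c''} S0
      rw [hu, hi, cnt_empty', PPSharpP.cnt_noTrue] at h
      omega
    rw [hf, ht]
    ring
  rw [h0, h1]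
  have : 2 ^ (K + 2) = 2 * 2 ^ (K + 1) := by ring
  omega

/-- **The inner count, branch `F ≤ val γ`** (`d = 0`, `b₁ = 1`, consistent and accepting):
`2·#accepted + 4·#S0 = 2^{K+2} + 4·val γ + 2`. [cite: Toran1991, §4] -/
theorem two_mul_cnt_inner_ge (K : ℕ) (hrest : mm + TT ≤ rest.length) (hΓ : 2 * bitsToNat GA + 1 ≤ 2 ^ (K + 1)) (hco : CO) :
    2 * cnt (K + 2) {c | boolPair v01 c ∈ 𝒲 P} + 4 * cnt K S0 = 2 ^ (K + 2) + 4 * bitsToNat GA + 2 := by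
  have hread : ∀ (e e' : Bool) (c'' : List Bool), boolPair v01 (e :: e' :: c'') ∈ 𝒲 P ↔
      ((e = true ∧ c'' ∉ S0) ∨ (e = false ∧ bitsToNat (e' :: c'') < 2 * bitsToNat GA + 1)) := by
    intro e e' c''
    rw [mem_𝒲_iff P x false true b₂ rest e e' c'' hrest]
    constructor
    · rintro ((⟨⟨⟨-, h⟩, -⟩, -⟩ | ⟨-, h⟩) | (⟨⟨-, h⟩, -⟩ | ⟨⟨h, -⟩, -⟩))
      · cases h
      · exact h
      · exact absurd hco h
      · cases h
    · intro h
      exact Or.inl (Or.inr ⟨⟨⟨rfl, rfl⟩, hco⟩, h⟩)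
  rw [cnt_succ]
  have h0 : cnt (K + 1) {c | false :: c ∈ {c | boolPair v01 c ∈ 𝒲 P}} = 2 * bitsToNat GA + 1 := by
    rw [← cnt_lt_val hΓ]
    refine cnt_congr fun c hc => ?_
    obtain ⟨e', c'', rfl⟩ := exists_eq_cons hc
    change boolPair v01 (false :: e' :: c'') ∈ 𝒲 P ↔ bitsToNat (e' :: c'') < 2 * bitsToNat GA + 1
    rw [hread]
    simp
  have h1 : cnt (K + 1) {c | true :: c ∈ {c | boolPair v01 c ∈ 𝒲 P}} + 2 * cnt K S0 = 2 ^ (K + 1) := by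
    rw [cnt_succ_of_iff K _ (fun _ c'' => c'' ∉ S0) (fun e' c'' => by
      change boolPair v01 (true :: e' :: c'') ∈ 𝒲 P ↔ _
      rw [hread]; simp)]
    have hc := cnt_add_cnt_compl K S0
    have he : {c'' : List Bool | c'' ∉ S0} = (S0)ᶜ := rfl
    rw [he, pow_succ]
    omega
  have : 2 ^ (K + 2) = 2 * 2 ^ (K + 1) := by ring
  omega

variable (d b₁)

/-- **The inner vote on a constant branch**: if membership does not depend on the coins, all or
none of them accept. [folklore] -/
theorem cnt_inner_const (K : ℕ) (c₀ : Prop)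
    (hread : ∀ (e e' : Bool) (c'' : List Bool), boolPair vv (e :: e' :: c'') ∈ 𝒲 P ↔ c₀) :
    (2 ^ (K + 2) < 2 * cnt (K + 2) {c | boolPair vv c ∈ 𝒲 P}) ↔ c₀ := by
  by_cases h : c₀
  · rw [cnt_eq_two_pow_of_forall fun c hc => ?_]
    · simp only [h, iff_true]
      have := Nat.two_pow_pos (K + 2)
      omega
    · obtain ⟨e, e', c'', rfl⟩ := exists_eq_cons_cons hc
      exact (hread e e' c'').2 h
  · rw [(cnt_congr fun c hc => ?_ : cnt _ {c | boolPair vv c ∈ 𝒲 P} = cnt _ ∅), cnt_empty']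
    · simp [h]
    · obtain ⟨e, e', c'', rfl⟩ := exists_eq_cons_cons hc
      simp only [Set.mem_setOf_eq, Set.mem_empty_iff_false, iff_false]
      exact fun hm => h ((hread e e' c'').1 hm)

/-- **Reading the inner vote.** For `|rest| = N` (hence `|as| = T`, `|γ| = T·Bw`): `v ∈ Evote` iff the
acceptance condition `ToranCH.Phi` of the outer count holds. [cite: Toran1991, §4] -/
theorem mem_Evote_iff_Phi (hs : ∀ z, (P.Q z).length ≤ P.s.eval z.length) (hN : rest.length = P.NP.eval x.length) :
    vv ∈ Evote P ↔ Phi (ConsP P x) (OutP P x) (FvP P x) d b₁ b₂ (rest.take mm) AS GA := by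
  rw [Data.eval_NP] at hN
  have hrest : mm + TT ≤ rest.length := by rw [hN]; omega
  have hlen : (vv).length = 2 * x.length + 2 + (rest.length + 3) := by simp [length_boolPair]
  obtain ⟨K, hK, hKle⟩ := exists_K P x rest
  have hΓ : 2 * bitsToNat GA + 1 ≤ 2 ^ (K + 1) := by
    have h1 := bitsToNat_lt GA
    rw [List.length_drop, hN, show mm + (TT + TT * BW) - (mm + TT) = TT * BW by omega] at h1
    have h2 : 2 ^ (TT * BW + 1) ≤ 2 ^ (K + 1) := Nat.pow_le_pow_right two_pos (by nlinarith)
    rw [pow_succ] at h2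
    omega
  have happ : AS ++ GA = rest.drop mm := by rw [← List.drop_drop, List.take_append_drop]
  -- the witness count is the aggregated true count
  have hy : (rest.take mm).length = mm := by rw [List.length_take, min_eq_left]; omega
  have hF : cnt K S0 = FvP P x (rest.take mm) AS := by
    rw [cnt_S0set (R := RR) hKle (fun j hj => rho_qry_le hs x _ _ hy hj.le), FvP, Fval]
    simp only [Data.κ]
    exact Finset.sum_congr rfl fun j _ => by rw [mul_comm j]
  have hread := fun e e' c'' => mem_𝒲_iff P x d b₁ b₂ rest e e' c'' hrest
  change 1 / 2 < uniformProb (P.C0P.eval (vv).length) {c | boolPair vv c ∈ 𝒲 P} ↔ _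
  rw [hlen, half_lt_uniformProb_iff, hK, Phi, happ]
  simp only [ConsP, OutP]
  rw [← hF]
  cases d with
  | true =>
    rw [cnt_inner_const P x true b₁ b₂ rest K (b₁ = false ∧ ¬ (b₂ = false ∧ true ∉ rest.drop mm)) (fun e e' c'' => by
      rw [hread]
      constructor
      · rintro ((⟨⟨⟨h, -⟩, -⟩, -⟩ | ⟨⟨⟨h, -⟩, -⟩, -⟩) | (⟨⟨h, -⟩, -⟩ | ⟨⟨-, hb⟩, hc⟩))
        · cases h
        · cases h
        · cases h
        · exact ⟨hb, hc⟩
      · rintro ⟨hb, hc⟩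
        exact Or.inr (Or.inr ⟨⟨rfl, hb⟩, hc⟩))]
    constructor
    · rintro ⟨hb, hc⟩
      exact Or.inr ⟨rfl, hb, hc⟩
    · rintro (⟨h, -⟩ | ⟨-, hb, hc⟩)
      · cases h
      · exact ⟨hb, hc⟩
  | false =>
    cases b₁ with
    | false =>
      by_cases hco : CO
      · have h := two_mul_cnt_inner_le P x b₂ rest K hrest (by omega) hco
        constructor
        · intro hlt
          exact Or.inl ⟨rfl, Or.inl ⟨rfl, hco, by omega⟩⟩
        · rintro (⟨-, hcase⟩ | ⟨h, -⟩)
          · rcases hcase with ⟨-, -, hle⟩ | ⟨h, -⟩ | ⟨h, -⟩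
            · omega
            · cases h
            · cases h
          · cases h
      · rw [cnt_inner_const P x false false b₂ rest K False (fun e e' c'' => by
          rw [hread]
          constructor
          · rintro ((⟨⟨-, h⟩, -⟩ | ⟨⟨⟨-, h⟩, -⟩, -⟩) | (⟨-, h⟩ | ⟨⟨h, -⟩, -⟩))
            · exact hco h
            · cases h
            · cases h
            · cases h
          · exact False.elim)]
        constructor
        · exact False.elim
        · rintro (⟨-, hcase⟩ | ⟨h, -⟩)
          · rcases hcase with ⟨-, h, -⟩ | ⟨h, -⟩ | ⟨h, -⟩
            · exact hco h
            · cases h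
            · cases h
          · cases h
    | true =>
      by_cases hco : CO
      · have h := two_mul_cnt_inner_ge P x b₂ rest K hrest hΓ hco
        constructor
        · intro hlt
          exact Or.inl ⟨rfl, Or.inr (Or.inl ⟨rfl, hco, by omega⟩)⟩
        · rintro (⟨-, hcase⟩ | ⟨h, -⟩)
          · rcases hcase with ⟨h, -⟩ | ⟨-, -, hle⟩ | ⟨-, hnco⟩
            · cases h
            · omega
            · exact absurd hco hnco
          · cases h
      · rw [cnt_inner_const P x false true b₂ rest K True (fun e e' c'' => by
          rw [hread]
          exact ⟨fun _ => trivial, fun _ => Or.inr (Or.inl ⟨⟨rfl, hco⟩, rfl⟩)⟩)]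
        exact ⟨fun _ => Or.inl ⟨rfl, Or.inr (Or.inr ⟨rfl, hco⟩)⟩, fun _ => trivial⟩

end Inner

/-! ### The outer vote -/

section Outer

variable {P : Data} {A : Language Bool}

/-- **The level-one theorem for one data set**: the outer vote with witness `Evote P` and `NP + 3`
coins decides `L`. [cite: Toran1991, §4] -/
theorem outer_iff (hs : ∀ z, (P.Q z).length ≤ P.s.eval z.length)
    (hA : ∀ z, z ∈ A ↔ 2 ^ P.ρ z < 2 * P.κ z) (x : List Bool) :
    1 / 2 < uniformProb ((P.NP + 3).eval x.length) {u | boolPair x u ∈ Evote P} ↔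
      1 / 2 < uniformProb (P.p.eval x.length) {y | boolPair x y ∈ adLang P.Q P.q P.DW A} := by
  have h3 : (P.NP + 3).eval x.length =
      P.p.eval x.length + (P.TP.eval x.length + P.TP.eval x.length * P.BwP.eval x.length) + 3 := by
    rw [eval_add, Data.eval_NP]; simp
  rw [h3, half_lt_uniformProb_iff, half_lt_uniformProb_iff]
  -- the outer event agrees with `Ehat` on strings of length `N + 3`
  have hEhat : cnt (P.p.eval x.length + (P.TP.eval x.length + P.TP.eval x.length * P.BwP.eval x.length) + 3)
      {u | boolPair x u ∈ Evote P} =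
      cnt (P.p.eval x.length + (P.TP.eval x.length + P.TP.eval x.length * P.BwP.eval x.length) + 3)
        (Ehat (P.p.eval x.length) (P.TP.eval x.length) (ConsP P x) (OutP P x) (FvP P x)) := by
    refine cnt_congr fun u hu => ?_
    obtain ⟨d, b₁, b₂, rest, rfl⟩ : ∃ d b₁ b₂ rest, u = d :: b₁ :: b₂ :: rest := by
      match u, hu with
      | d :: b₁ :: b₂ :: rest, _ => exact ⟨d, b₁, b₂, rest, rfl⟩
    have hN : rest.length = P.NP.eval x.length := by
      rw [Data.eval_NP]; simp only [List.length_cons] at hu; omega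
    rw [Set.mem_setOf_eq, mem_Evote_iff_Phi P x d b₁ b₂ rest hs hN, cons_mem_Ehat_iff]
  rw [hEhat, majority_Ehat_iff (ConsP := ConsP P x) (OutP := OutP P x) (Fv := FvP P x) (Bw := P.BwP.eval x.length)
    (fun y => adBits P.Q A (boolPair x y) (P.TP.eval x.length))
    (fun y => gamStar P.Q A P.κ (boolPair x y) (P.TP.eval x.length) (P.BwP.eval x.length))
    (fun y => length_adBits _ _ _) (fun y => length_gamStar) (fun y as γ hy has hγ => by
      unfold ConsP FvP
      exact cons_and_F_eq_iff hA (fun as j hj => kappa_qry_lt hs x y as hy hj) has hγ)]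
  -- the accepting `y` are those with `w ∈ W = adLang Q q DW A`
  refine Iff.of_eq (congrArg _ (congrArg _ (cnt_congr fun y hy => ?_)))
  simp only [Set.mem_setOf_eq, OutP, mem_adLang_iff]
  rw [show P.q.eval (boolPair x y).length = P.TP.eval x.length by rw [length_boolPair, hy, Data.eval_TP]]

end Outer

end ToranCH

open ToranCH

/-! ### The relativised level-one theorem and Torán's characterisation -/

/-- **`C'·(P^A) ⊆ C'·C'·(P^O)` for `A ∈ C'·(P^O)`** (relativised `PP^{PP^O} ⊆ C'·PP^O`): the heart
of Torán's oracle characterisation, by guessing the oracle answers together with the witness counts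
of the queries (module docstring). [cite: Toran1991, §4] -/
theorem pMajority_PRel_subset_of_mem_pMajority (O : Oracle) {A : Language Bool} (hA : A ∈ pMajority (PRel O)) :
    pMajority (PRel (Oracle.ofLanguage A)) ⊆ pMajority (pMajority (PRel O)) := by
  rintro L ⟨W, hW, p, hp⟩
  obtain ⟨Q, hQ, s, hs, DW, hDW, q, rfl⟩ := exists_eq_adLang_of_mem_PRel' hW
  obtain ⟨DA, hDA, r, hr⟩ := hA
  let P : Data := ⟨p, q, r, s, Q, DW, DA⟩
  have hA' : ∀ z, z ∈ A ↔ 2 ^ P.ρ z < 2 * P.κ z := fun z => by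
    rw [hr z, half_lt_uniformProb_iff]; rfl
  refine ⟨Evote P, Evote_mem_pMajority hQ hDW hDA, P.NP + 3, fun x => ?_⟩
  rw [hp x]
  exact (outer_iff (P := P) hs hA' x).symm

/-- `PP^A ⊆ Cₖ₊₁P` for `A ∈ CₖP` (induction on `k` from the level-one theorem). [cite: Toran1991, §4] -/
theorem PPRel_subset_CkP_succ : ∀ (k : ℕ) {A : Language Bool}, A ∈ CkP k → PPRel (Oracle.ofLanguage A) ⊆ CkP (k + 1)
  | 0, A, hA => by
    rw [PPRel_eq, CkP_succ, CkP_zero]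
    exact pMajority_mono fun L hL => PRelClass_P_subset_P (mem_PRelClass_iff.2 ⟨A, hA, hL⟩)
  | k + 1, A, hA => by
    obtain ⟨B, hB, p, hp⟩ := (show A ∈ pMajority (CkP k) from hA)
    have hA' : A ∈ pMajority (PRel (Oracle.ofLanguage B)) := ⟨B, self_mem_PRel_ofLanguage_holds B, p, hp⟩
    rw [PPRel_eq]
    refine (pMajority_PRel_subset_of_mem_pMajority _ hA').trans ?_
    rw [CkP_succ]
    exact pMajority_mono (PPRel_subset_CkP_succ k hB)

/-- **Discharge of `CkP_succ_eq_PPRelClass`** — Torán's oracle characterisation of the counting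
hierarchy, `Cₖ₊₁P = PP^{CₖP}` for every `k` (J. ACM 38 (1991), §4; Bürgisser 2009, (3)).
[cite: Toran1991, §4] -/
theorem CkP_succ_eq_PPRelClass_holds : CkP_succ_eq_PPRelClass := by
  intro k
  refine Set.Subset.antisymm ?_ ?_
  · rintro L ⟨W, hW, p, hp⟩
    refine Set.mem_biUnion (t := fun B => PPRel (Oracle.ofLanguage B)) hW ?_
    rw [PPRel_eq]
    exact ⟨W, self_mem_PRel_ofLanguage_holds W, p, hp⟩
  · intro L hL
    obtain ⟨B, hB, hLB⟩ : ∃ B ∈ CkP k, L ∈ PPRel (Oracle.ofLanguage B) := by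
      simpa only [PPRelClass, Set.mem_iUnion, exists_prop] using hL
    exact PPRel_subset_CkP_succ k hB hLB

end Literature.Computability.Complexity
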